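import Summits.BirchSwinnertonDyer.BirchSwinnertonDyer.Theorems.CumulativeHeegnerLeopoldtCumulativeHeegnerInclusionAtThreeLayerControlLocalAnnihilator
import Summits.BirchSwinnertonDyer.BirchSwinnertonDyer.Theorems.CumulativeHeegnerLeopoldtCumulativeHeegnerInclusionAtThreeLayerTower
import HarnessLib

/-!
# Crux K1 `CumulativeHeegnerInclusionAtThree` (stmt-BirchSwinnertonDyer-24198) / crux A (stmt-26896): the
# port [P-ctl], VIII (door) — A and K1 BY NAME from a layer tower for ANY finite `Σ` (K1's own `Σ = ∅` included)
# plus a UNIFORM LOCAL ANNIHILATOR at the bad places outside `Σ` (Greenberg's Lemma 3.3 shape) — no other control input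

Width seat bsd-line-chl-k1-p1-w8 (`--supports stmt-BirchSwinnertonDyer-24198`). THEOREMS ONLY (no definition, no named
fact, no `sorry`). DOOR file: imports the route's (LT) door `…LayerTower` (p637184) and the route-independent supplier
`…LayerControlLocalAnnihilator` ([P-ctl] VIII). Companion of `…LayerTowerSigmaDoor` (V-b: the EXACT-control door for
`Σ ⊇ {bad v ∤ 3}`); here `Σ` is any finite set, and the price of the missing places is ONE number: an exponent `a` with `3^a`
killing the local kernels `ker (H¹(K_{n,w}, E[3^∞]) → H¹(K_{∞,η}, E[3^∞]))` at every layer `n` and every bad `v ∉ Σ`, `v ∤ 3`, not split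
completely in `K_∞` — by Greenberg (LNM 1716, §3, Lemma 3.3) these kernels have bounded order along the tower, so such an `a`
exists in print; it is kept as a displayed hypothesis (no named fact is minted here).

* **`temperedHeegnerInclusionAtThree_of_fittingLayerTower_of_localKernelAnnihilator`** — A (`TemperedHeegnerInclusionAtThree`,
  crux 26896) BY NAME from: at every frame, a finite `Σ`, a uniform local annihilator `3^a`, a uniform `μ`, and at every layer
  `m` a layer element `θ_m ∈ Fitt_Λ(Hom(Sel_{𝔭′}^Σ(K_m, E[3^∞]), ℚ/ℤ))·R₀⟦T⟧` with `3^μ L ∈ (θ_m) + (3^m) + (ω_m)`.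
* **`cumulativeHeegnerInclusionAtThree_of_print_of_fittingLayerTower_of_localKernelAnnihilator`** — K1 BY NAME from P ∧ the same.

What remains RESEARCH: [R-layer-KS] (the layer elements `θ_m` from an equivariant residually-reducible Kolyvagin argument) and
[R-layer-rec] (`θ_m ≡ u·3^μ L`), unprinted at additive `3`; what remains PORT: Greenberg's Lemma 3.3 along the anticyclotomic
tower in the tree's cocycle vocabulary (the hypothesis `a`). Crux A (26896) and K1 (24198) stay OPEN; BSD is not proved by any
of this; no summit statement is proved by this seat.

References: [GreenbergLNM1716] §3 Lemma 3.3 and p. 90; [MazurTate1987] §1; [KimKurihara2021] §1; [BertoliniDarmon1990] §2;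
[CastellaGrossiLeeSkinner2022] §1.2 Prop. 14 (arXiv:2008.02571).
-/

set_option linter.dupNamespace false
set_option autoImplicit false

noncomputable section

open scoped Classical

namespace Summit.BirchSwinnertonDyer.BirchSwinnertonDyer.Theorems.CumulativeHeegnerInclusionAtThreeLayerTowerLocalAnnihilatorDoor

open NumberField IsDedekindDomain Field
open Literature.NumberTheory.EllipticCurves
open Summit.BirchSwinnertonDyer.Rank1Residual.X11b Summit.BirchSwinnertonDyer.Rank1Residual.X11b.AcSelmer
open Summit.BirchSwinnertonDyer.BirchSwinnertonDyer.Theorems.CumulativeHeegnerInclusionAtThreeLayerTower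
open Summit.BirchSwinnertonDyer.BirchSwinnertonDyer.Theorems.CumulativeHeegnerInclusionAtThreeLayerControlLocalAnnihilator

/-- **A BY NAME from a `Σ`-layer tower + a uniform local annihilator (any finite `Σ`, e.g. K1's `Σ = ∅`).** At every frame of
crux A: a finite `Σ`, an exponent `a` with `3^a` killing `ker r_{n,v}` for all layers `n` and all bad `v ∉ Σ`, `v ∤ 3`, not split
completely in `K_∞` (Greenberg's Lemma 3.3 shape), a uniform `μ`, and at every layer `m` a layer element
`θ_m ∈ Fitt_Λ(Hom(Sel_{𝔭′}^Σ(K_m, E[3^∞]), ℚ/ℤ))·R₀⟦T⟧` (any presentation `(f, h)`) with `3^μ L ∈ (θ_m) + (3^m) + (ω_m)` ⟹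
`TemperedHeegnerInclusionAtThree` (VIII `cell_fittingLayerTower_of_layerTower_of_localKernelAnnihilator` + the (LT) door, with
`μ′ = μ + a·G`). Nothing about the existence of such layer elements at additive `3` is asserted.
[cite: GreenbergLNM1716, §3 Lemma 3.3 and p. 90] [cite: KimKurihara2021, §1] [cite: MazurTate1987, §1] -/
theorem temperedHeegnerInclusionAtThree_of_fittingLayerTower_of_localKernelAnnihilator
    (hLT : ∀ (W : WeierstrassCurve ℚ) [W.IsElliptic] [W.IsGloballyMinimal] (N : ℕ) [NeZero N] (K : Type) [Field K] [NumberField K] (Dt : Literature.NumberTheory.EllipticCurves.ModularForms.ModularParametrizationData W N), Summit.BirchSwinnertonDyer.Rank1Residual.Additive.ClassO6 W 3 → Literature.NumberTheory.EllipticCurves.Rank1Residual.Red W 3 → (∃ Φ : AddSubgroup (WeierstrassCurve.geomTorsion W ((3 : ℕ) : ℤ)), Literature.NumberTheory.EllipticCurves.Rank1Residual.IsRationalLine W 3 Φ ∧ ∀ (v : IsDedekindDomain.HeightOneSpectrum (NumberField.RingOfIntegers ℚ)), ((3 : ℕ) : NumberField.RingOfIntegers ℚ) ∈ v.asIdeal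 → ∀ 𝔓 ∈ v.primesAbove, ¬ (∀ g ∈ 𝔓.decompositionSubgroup (Field.absoluteGaloisGroup ℚ), ∀ P ∈ Φ, g • P = P) ∧ ¬ (∀ g ∈ 𝔓.decompositionSubgroup (Field.absoluteGaloisGroup ℚ), ∀ P : WeierstrassCurve.geomTorsion W ((3 : ℕ) : ℤ), g • P - P ∈ Φ)) → W.analyticRank = 1 → W.conductorNorm ℤ = N → Literature.NumberTheory.EllipticCurves.IsImaginaryQuadratic K → Literature.NumberTheory.EllipticCurves.SatisfiesHeegnerHypothesis N K → ∀ (κ : Literature.NumberTheory.EllipticCurves.ZpExtension K 3), κ.IsAnticyclotomic → ∀ (γ : Field.absoluteGaloisGroup K) [Fact (κ.IsTopGenerator γ)] (𝔭 : IsDedekindDomain.HeightOneSpectrum (NumberField.RingOfIntegers K)), ((3 : ℕ) : NumberField.RingOfIntegers K) ∈ 𝔭.asIdeal → 𝔭.asIdeal.ramificationIdx (NumberField.RingOfIntegers ℚ) = 1 → 𝔭.asIdeal.inertiaDeg (NumberField.RingOfIntegers ℚ) = 1 → ∀ (𝔭' : IsDedekindDomain.HeightOneSpectrum (NumberField.RingOfIntegers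 K)), ((3 : ℕ) : NumberField.RingOfIntegers K) ∈ 𝔭'.asIdeal → 𝔭' ≠ 𝔭 → ∀ (ι' : PadicAlgCl 3 ≃+* ℂ), Summit.BirchSwinnertonDyer.BirchSwinnertonDyer.Theorems.SchneiderFree.BranchInducesPrime 3 ι' 𝔭 → ∀ (ΩK : ℂ) (Ωp : ℂ_[3]) (L : Literature.NumberTheory.EllipticCurves.UnrSeries 3), ΩK ≠ 0 → Ωp ≠ 0 → Literature.NumberTheory.EllipticCurves.IsBDPLFunction ι' 𝔭 κ γ Dt.f ΩK Ωp L →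
      haveI : (W.baseChange K).IsElliptic := inferInstanceAs (W.map (algebraMap ℚ K)).IsElliptic
      ∃ (S : Set (IsDedekindDomain.HeightOneSpectrum (NumberField.RingOfIntegers K))), S.Finite ∧
        ∃ a : ℕ, (∀ (n : ℕ) (v : IsDedekindDomain.HeightOneSpectrum (NumberField.RingOfIntegers K)),
          ((3 : ℕ) : NumberField.RingOfIntegers K) ∉ v.asIdeal → v ∉ S →
            ¬ Literature.NumberTheory.EllipticCurves.GreenbergSelmer.decomp v ≤ κ.kerSubgroup →
            ¬ (W.baseChange K).HasGoodReductionAt v →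
              ∀ y : (W.baseChange K).subgroupH1 3 (κ.layerSubgroup n ⊓
                  Literature.NumberTheory.EllipticCurves.GreenbergSelmer.decomp v),
                (W.baseChange K).resOfLe 3 (inf_le_inf_right (Literature.NumberTheory.EllipticCurves.GreenbergSelmer.decomp v)
                  (κ.kerSubgroup_le_layerSubgroup n)) y = 0 → 3 ^ a • y = 0) ∧
        ∃ μ : ℕ, ∀ m : ℕ,
          ∃ (f : AddMonoid.End ↥(Summit.BirchSwinnertonDyer.Rank1Residual.X11b.AcSelmer.selmerOver (κ.layerSubgroup m)
              ((W.baseChange K).geomPrimaryTorsion 3) 3 𝔭' S))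
            (_ : ∀ s, ((f s : Summit.BirchSwinnertonDyer.Rank1Residual.X11b.AcSelmer.selmerOver (κ.layerSubgroup m)
              ((W.baseChange K).geomPrimaryTorsion 3) 3 𝔭' S) : (W.baseChange K).subgroupH1 3 (κ.layerSubgroup m)) =
                (W.baseChange K).conjH1 3 (κ.layerSubgroup m) γ s)
            (h : Literature.NumberTheory.EllipticCurves.IwasawaDual.IsLocNil 3 (f - 1))
            (θ : Literature.NumberTheory.EllipticCurves.UnrSeries 3),
            θ ∈ (Literature.RingTheory.FittingIdeal.Module.fittingIdeal (Literature.NumberTheory.EllipticCurves.IwasawaAlgebra 3)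
              (Summit.BirchSwinnertonDyer.BirchSwinnertonDyer.Theorems.BiquadraticEisensteinDescentDefs.LocNilDual
                (Summit.BirchSwinnertonDyer.Rank1Residual.X11b.AcSelmer.selmerOver (κ.layerSubgroup m)
                  ((W.baseChange K).geomPrimaryTorsion 3) 3 𝔭' S) f h) 0).map
                (PowerSeries.map (Summit.BirchSwinnertonDyer.Rank1Residual.X11b.Halves.toUnr 3)) ∧
            (3 : Literature.NumberTheory.EllipticCurves.UnrSeries 3) ^ μ * L ∈ Ideal.span {θ} ⊔
              Ideal.span {(3 : Literature.NumberTheory.EllipticCurves.UnrSeries 3) ^ m} ⊔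
              Ideal.span {((1 + PowerSeries.X) ^ (3 ^ m) - 1 : Literature.NumberTheory.EllipticCurves.UnrSeries 3)}) :
    Summit.BirchSwinnertonDyer.BirchSwinnertonDyer.Theses.CumulativeHeegnerLeopoldt.TemperedHeegnerInclusionAtThree := by
  refine temperedHeegnerInclusionAtThree_of_fittingLayerTower ?_
  intro W _ _ N _ K _ _ Dt hO6 hRed hcell hr hN hK hHg κ hκ γ _ 𝔭 h𝔭 he hf 𝔭' h𝔭' hne ι' hι ΩK Ωp L hΩK hΩp hBDP
  obtain ⟨S, hSfin, a, hloc, μ, hT⟩ :=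
    hLT W N K Dt hO6 hRed hcell hr hN hK hHg κ hκ γ 𝔭 h𝔭 he hf 𝔭' h𝔭' hne ι' hι ΩK Ωp L hΩK hΩp hBDP
  exact cell_fittingLayerTower_of_layerTower_of_localKernelAnnihilator W N K hO6 hcell hN hK hHg κ γ 𝔭' h𝔭' S hSfin a
    hloc μ L hT

/-- **K1 BY NAME from P ∧ (`Σ`-layer tower + uniform local annihilator)**: the print input P
(`ResidualSelmerPrintedInputAtThree`, CGLS22 Prop. 14, item 26897) and the layer data above give the route crux
`CumulativeHeegnerInclusionAtThree` (`…LayerTower.cumulativeHeegnerInclusionAtThree_of_print_of_fittingLayerTower` fed with VIII).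
[cite: CastellaGrossiLeeSkinner2022, §1.2 Prop. 14 (arXiv:2008.02571)] [cite: GreenbergLNM1716, §3 Lemma 3.3] -/
theorem cumulativeHeegnerInclusionAtThree_of_print_of_fittingLayerTower_of_localKernelAnnihilator
    (hP : Summit.BirchSwinnertonDyer.BirchSwinnertonDyer.Theses.CumulativeHeegnerLeopoldt.ResidualSelmerPrintedInputAtThree)
    (hLT : ∀ (W : WeierstrassCurve ℚ) [W.IsElliptic] [W.IsGloballyMinimal] (N : ℕ) [NeZero N] (K : Type) [Field K] [NumberField K] (Dt : Literature.NumberTheory.EllipticCurves.ModularForms.ModularParametrizationData W N), Summit.BirchSwinnertonDyer.Rank1Residual.Additive.ClassO6 W 3 → Literature.NumberTheory.EllipticCurves.Rank1Residual.Red W 3 → (∃ Φ : AddSubgroup (WeierstrassCurve.geomTorsion W ((3 : ℕ) : ℤ)), Literature.NumberTheory.EllipticCurves.Rank1Residual.IsRationalLine W 3 Φ ∧ ∀ (v : IsDedekindDomain.HeightOneSpectrum (NumberField.RingOfIntegers ℚ)), ((3 : ℕ) : NumberField.RingOfIntegers ℚ) ∈ v.asIdeal → ∀ 𝔓 ∈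 v.primesAbove, ¬ (∀ g ∈ 𝔓.decompositionSubgroup (Field.absoluteGaloisGroup ℚ), ∀ P ∈ Φ, g • P = P) ∧ ¬ (∀ g ∈ 𝔓.decompositionSubgroup (Field.absoluteGaloisGroup ℚ), ∀ P : WeierstrassCurve.geomTorsion W ((3 : ℕ) : ℤ), g • P - P ∈ Φ)) → W.analyticRank = 1 → W.conductorNorm ℤ = N → Literature.NumberTheory.EllipticCurves.IsImaginaryQuadratic K → Literature.NumberTheory.EllipticCurves.SatisfiesHeegnerHypothesis N K → ∀ (κ : Literature.NumberTheory.EllipticCurves.ZpExtension K 3), κ.IsAnticyclotomic → ∀ (γ : Field.absoluteGaloisGroup K) [Fact (κ.IsTopGenerator γ)] (𝔭 : IsDedekindDomain.HeightOneSpectrum (NumberField.RingOfIntegers K)), ((3 : ℕ) : NumberField.RingOfIntegers K) ∈ 𝔭.asIdeal → 𝔭.asIdeal.ramificationIdx (NumberField.RingOfIntegers ℚ) = 1 → 𝔭.asIdeal.inertiaDeg (NumberField.RingOfIntegers ℚ) = 1 → ∀ (𝔭' : IsDedekindDomain.HeightOneSpectrum (NumberField.RingOfIntegers K)), ((3 :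 ℕ) : NumberField.RingOfIntegers K) ∈ 𝔭'.asIdeal → 𝔭' ≠ 𝔭 → ∀ (ι' : PadicAlgCl 3 ≃+* ℂ), Summit.BirchSwinnertonDyer.BirchSwinnertonDyer.Theorems.SchneiderFree.BranchInducesPrime 3 ι' 𝔭 → ∀ (ΩK : ℂ) (Ωp : ℂ_[3]) (L : Literature.NumberTheory.EllipticCurves.UnrSeries 3), ΩK ≠ 0 → Ωp ≠ 0 → Literature.NumberTheory.EllipticCurves.IsBDPLFunction ι' 𝔭 κ γ Dt.f ΩK Ωp L →
      haveI : (W.baseChange K).IsElliptic := inferInstanceAs (W.map (algebraMap ℚ K)).IsElliptic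
      ∃ (S : Set (IsDedekindDomain.HeightOneSpectrum (NumberField.RingOfIntegers K))), S.Finite ∧
        ∃ a : ℕ, (∀ (n : ℕ) (v : IsDedekindDomain.HeightOneSpectrum (NumberField.RingOfIntegers K)),
          ((3 : ℕ) : NumberField.RingOfIntegers K) ∉ v.asIdeal → v ∉ S →
            ¬ Literature.NumberTheory.EllipticCurves.GreenbergSelmer.decomp v ≤ κ.kerSubgroup →
            ¬ (W.baseChange K).HasGoodReductionAt v →
              ∀ y : (W.baseChange K).subgroupH1 3 (κ.layerSubgroup n ⊓
                  Literature.NumberTheory.EllipticCurves.GreenbergSelmer.decomp v),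
                (W.baseChange K).resOfLe 3 (inf_le_inf_right (Literature.NumberTheory.EllipticCurves.GreenbergSelmer.decomp v)
                  (κ.kerSubgroup_le_layerSubgroup n)) y = 0 → 3 ^ a • y = 0) ∧
        ∃ μ : ℕ, ∀ m : ℕ,
          ∃ (f : AddMonoid.End ↥(Summit.BirchSwinnertonDyer.Rank1Residual.X11b.AcSelmer.selmerOver (κ.layerSubgroup m)
              ((W.baseChange K).geomPrimaryTorsion 3) 3 𝔭' S))
            (_ : ∀ s, ((f s : Summit.BirchSwinnertonDyer.Rank1Residual.X11b.AcSelmer.selmerOver (κ.layerSubgroup m)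
              ((W.baseChange K).geomPrimaryTorsion 3) 3 𝔭' S) : (W.baseChange K).subgroupH1 3 (κ.layerSubgroup m)) =
                (W.baseChange K).conjH1 3 (κ.layerSubgroup m) γ s)
            (h : Literature.NumberTheory.EllipticCurves.IwasawaDual.IsLocNil 3 (f - 1))
            (θ : Literature.NumberTheory.EllipticCurves.UnrSeries 3),
            θ ∈ (Literature.RingTheory.FittingIdeal.Module.fittingIdeal (Literature.NumberTheory.EllipticCurves.IwasawaAlgebra 3)
              (Summit.BirchSwinnertonDyer.BirchSwinnertonDyer.Theorems.BiquadraticEisensteinDescentDefs.LocNilDual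
                (Summit.BirchSwinnertonDyer.Rank1Residual.X11b.AcSelmer.selmerOver (κ.layerSubgroup m)
                  ((W.baseChange K).geomPrimaryTorsion 3) 3 𝔭' S) f h) 0).map
                (PowerSeries.map (Summit.BirchSwinnertonDyer.Rank1Residual.X11b.Halves.toUnr 3)) ∧
            (3 : Literature.NumberTheory.EllipticCurves.UnrSeries 3) ^ μ * L ∈ Ideal.span {θ} ⊔
              Ideal.span {(3 : Literature.NumberTheory.EllipticCurves.UnrSeries 3) ^ m} ⊔
              Ideal.span {((1 + PowerSeries.X) ^ (3 ^ m) - 1 : Literature.NumberTheory.EllipticCurves.UnrSeries 3)}) :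
    Summit.BirchSwinnertonDyer.BirchSwinnertonDyer.Theses.CumulativeHeegnerLeopoldt.CumulativeHeegnerInclusionAtThree := by
  refine cumulativeHeegnerInclusionAtThree_of_print_of_fittingLayerTower hP ?_
  intro W _ _ N _ K _ _ Dt hO6 hRed hcell hr hN hK hHg κ hκ γ _ 𝔭 h𝔭 he hf 𝔭' h𝔭' hne ι' hι ΩK Ωp L hΩK hΩp hBDP
  obtain ⟨S, hSfin, a, hloc, μ, hT⟩ :=
    hLT W N K Dt hO6 hRed hcell hr hN hK hHg κ hκ γ 𝔭 h𝔭 he hf 𝔭' h𝔭' hne ι' hι ΩK Ωp L hΩK hΩp hBDP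
  exact cell_fittingLayerTower_of_layerTower_of_localKernelAnnihilator W N K hO6 hcell hN hK hHg κ γ 𝔭' h𝔭' S hSfin a
    hloc μ L hT

end Summit.BirchSwinnertonDyer.BirchSwinnertonDyer.Theorems.CumulativeHeegnerInclusionAtThreeLayerTowerLocalAnnihilatorDoor

end
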